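import Mathlib.Analysis.Calculus.Deriv.Basic
import Mathlib.Analysis.Calculus.Deriv.Add
import Mathlib.Analysis.Calculus.Deriv.Mul
import Mathlib.Analysis.Calculus.Deriv.Inv
import Mathlib.Analysis.Calculus.Deriv.Pow
import Mathlib.Tactic.LinearCombination
import Mathlib.Tactic.FieldSimp
import HarnessLib

/-!
# `StokesGeneration` (stmt-KontsevichZagierPeriods-3586) — line `fibrewise_stokes`, stub `stub_ellipticTranslationDeriv`

Registered rung stub E1 (rung 17, the genus-one entry point) of the line `fibrewise_stokes` of the crux
`StokesGeneration` (route UnfoldedStokes): **translation invariance of `dx/y` on a Weierstrass cubic**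
`E : y² = f(x) = x³ + a₂x² + a₄x + a₆`, written as a one-variable `HasDerivAt` identity.

If `P = (x, y(x))` runs along a local branch of `E` (`y u ^ 2 = f u` for `u` near `x`, `y` differentiable
at `x`, `y x ≠ 0`) and `Q = (x₀, y₀) ∈ E` with `x ≠ x₀`, the chord `PQ` has slope
`λ = (y − y₀)/(x − x₀)`, its third intersection with `E` has abscissa `x₃ = λ² − a₂ − x − x₀` and ordinate
`y + λ(x₃ − x)`, and `P ⊕ Q = (x₃, y₃)` with `y₃ = −(y + λ(x₃ − x))`.  Invariance `τ_Q^*(dx/y) = dx/y`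
reads `dx₃/dx = y₃/y`, which is the statement below.

Proof.  Elementary calculus gives `dx₃/dx = 2λλ′ − 1` with `λ′ = (y′(x − x₀) − (y − y₀))/(x − x₀)²`
(`HasDerivAt.fun_div`, `.fun_pow`, `.sub_const`, `.fun_sub`).  Differentiating the curve equation along the
branch (`HasDerivAt.congr_of_eventuallyEq`, `HasDerivAt.unique`) gives `2·y·y′ = f′(x)`; together with
`y² = f(x)` and `y₀² = f(x₀)` the polynomial identity
`f′(x)(x − x₀) − (f(x) − f(x₀)) = (a₂ + 2x + x₀)(x − x₀)²` yields `2yλ′ + λ² = a₂ + 2x + x₀`, and then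
`2λλ′ − 1 = −(y + λ(λ² − a₂ − 2x − x₀))/y = y₃/y`.

References: J. H. Silverman, *The Arithmetic of Elliptic Curves* (2nd ed., 2009), III.2.3 (group law
formulas) and III.5.1 (invariance of the differential `dx/(2y + a₁x + a₃)` under translation);
M. Kontsevich, D. Zagier, *Periods* (2001), §1.2.
-/

noncomputable section

-- `Summit.KontsevichZagierPeriods.KontsevichZagierPeriods.…` is the tree's mandated layout (single-conjunct summit).
set_option linter.dupNamespace false

namespace Summit.KontsevichZagierPeriods.KontsevichZagierPeriods.Cruxes.StokesGeneration.FibrewiseStokes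

/-- **Registered stub `stub_ellipticTranslationDeriv` (rung 17, E1): translation invariance of `dx/y`.**
On the cubic `y² = x³ + a₂x² + a₄x + a₆`, along a local branch `y` through `(x, y x)` with `y x ≠ 0`, and
for a point `(x₀, y₀)` of the curve with `x₀ ≠ x`, the abscissa
`x₃(u) = ((y u − y₀)/(u − x₀))² − a₂ − u − x₀` of the translate `(u, y u) ⊕ (x₀, y₀)` satisfies
`dx₃/du = y₃/y` at `u = x`, where `y₃ = −(y + λ(x₃ − x))`, `λ = (y x − y₀)/(x − x₀)`.
[cite: SilvermanAEC2009, III.2.3 and III.5.1] -/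
theorem stub_ellipticTranslationDeriv (a₂ a₄ a₆ x₀ y₀ : ℝ) (y : ℝ → ℝ) (y' x : ℝ) (hx : x ≠ x₀)
    (hQ : y₀ ^ 2 = x₀ ^ 3 + a₂ * x₀ ^ 2 + a₄ * x₀ + a₆)
    (hP : ∀ᶠ u in nhds x, y u ^ 2 = u ^ 3 + a₂ * u ^ 2 + a₄ * u + a₆)
    (hyd : HasDerivAt y y' x) (hy : y x ≠ 0) :
    HasDerivAt (fun u => ((y u - y₀) / (u - x₀)) ^ 2 - a₂ - u - x₀)
      (-(y x + (y x - y₀) / (x - x₀) * (((y x - y₀) / (x - x₀)) ^ 2 - a₂ - x - x₀ - x)) / y x) x := by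
  have hD : x - x₀ ≠ 0 := sub_ne_zero.mpr hx
  -- the curve equation at `x`
  have hPx : y x ^ 2 = x ^ 3 + a₂ * x ^ 2 + a₄ * x + a₆ := hP.self_of_nhds
  -- the derivative of the cubic
  have hpoly : HasDerivAt (fun u : ℝ => u ^ 3 + a₂ * u ^ 2 + a₄ * u + a₆)
      (3 * x ^ 2 + 2 * a₂ * x + a₄) x := by
    refine (((((hasDerivAt_id' x).fun_pow 3).fun_add
      (((hasDerivAt_id' x).fun_pow 2).const_mul a₂)).fun_add
      ((hasDerivAt_id' x).const_mul a₄)).add_const a₆).congr_deriv ?_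
    norm_num
    ring
  -- differentiate `y u ^ 2 = f u` along the branch: `2 y y' = f'(x)`
  have hsq : HasDerivAt (fun u => y u ^ 2) (3 * x ^ 2 + 2 * a₂ * x + a₄) x :=
    hpoly.congr_of_eventuallyEq hP
  have hsq' : HasDerivAt (fun u => y u ^ 2) (2 * y x * y') x :=
    (hyd.fun_pow 2).congr_deriv (by norm_num)
  have hderiv : 2 * y x * y' = 3 * x ^ 2 + 2 * a₂ * x + a₄ := hsq'.unique hsq
  -- the key polynomial identity `2 y λ' (x - x₀)² + (y - y₀)² = (a₂ + 2x + x₀)(x - x₀)²`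
  have key : 2 * y x * (y' * (x - x₀) - (y x - y₀) * 1) + (y x - y₀) ^ 2
      = (a₂ + 2 * x + x₀) * (x - x₀) ^ 2 := by
    linear_combination (x - x₀) * hderiv - hPx + hQ
  -- divided by `(x - x₀)²`: `2 y λ' = (a₂ + 2x + x₀) - λ²`
  have key' : 2 * y x * ((y' * (x - x₀) - (y x - y₀) * 1) / (x - x₀) ^ 2)
      = (a₂ + 2 * x + x₀) - ((y x - y₀) / (x - x₀)) ^ 2 := by
    rw [eq_sub_iff_add_eq, div_pow, mul_div_assoc', ← add_div, div_eq_iff (pow_ne_zero 2 hD)]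
    exact key
  -- the slope `λ` and its derivative
  have hL : HasDerivAt (fun u => (y u - y₀) / (u - x₀))
      ((y' * (x - x₀) - (y x - y₀) * 1) / (x - x₀) ^ 2) x :=
    (hyd.sub_const y₀).fun_div ((hasDerivAt_id' x).sub_const x₀) hD
  have hL2 : HasDerivAt (fun u => ((y u - y₀) / (u - x₀)) ^ 2)
      (2 * ((y x - y₀) / (x - x₀)) * ((y' * (x - x₀) - (y x - y₀) * 1) / (x - x₀) ^ 2)) x :=
    (hL.fun_pow 2).congr_deriv (by norm_num)
  refine (((hL2.sub_const a₂).fun_sub (hasDerivAt_id' x)).sub_const x₀).congr_deriv ?_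
  rw [eq_div_iff hy]
  linear_combination (y x - y₀) / (x - x₀) * key'

end Summit.KontsevichZagierPeriods.KontsevichZagierPeriods.Cruxes.StokesGeneration.FibrewiseStokes

end
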